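import Summits.ABC.IUTFork.LDHSplitBadPrimeNumberField
import HarnessLib

/-!
# The fork at [IUTchIII] Corollary 3.12, L-DH level: over `F₀ = ℚ` the bad-mass escape is ABSENT — every bad prime is totally bad
# and the sufficient condition of the TRUE side never fires

Proof-only companion (D-0012; 0 definitions, no `Prop` fact) of abc-iut-c312-3's `GenuineLogThetaSplitBadPrimes.lean` and of
`LDHSplitBadPrimeNumberField.lean` / `LDHSplitBadPrimeBothSides.lean` / `LDHSplitBadPrimeLargeL.lean` (abc-iut-w5-d018 gen 4,
p430071 / p430278 / p430596). TAKES NO SIDE on [IUTchIII] Cor. 3.12.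

The three companions show that over every number field `F₀ ≠ ℚ` the typed `Cor312Of` of the sharp Dupuy–Hilado-level model is TRUE at
every depth for synthetic inputs whose bad place sits over a completely split prime (bad mass `β_p ≤ 1/2`, or `≤ β < 1` at large `l`).
The route to `Summit.ABC` runs over `F_mod = ℚ`. THIS FILE records, as kernel facts, why that escape is unavailable there:

* `badMass_eq_one_of_finrank_eq_one` — over a base field of degree one EVERY rational prime under a bad place has bad mass
  `β_p = 1` (the unique place over `p` has `n_v = [F₀:ℚ] = 1`, `Pr(v) = 1`);
* `sum_sq_gt_of_two_le` — `Σ_{i<m} (i+1)² > m` for `m ≥ 2`, so at `β_p = 1` the averaged coefficient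
  `c_p = (1/ℓ⋇)·Σ_{i<ℓ⋇}(i+1)² = (ℓ⋇+1)(2ℓ⋇+1)/6` exceeds `1`;
* **`not_badMass_condition_of_finrank_eq_one`** — for EVERY genuine Θ-volume input `I` over a degree-one base the hypothesis of
  abc-iut-c312-3's `cor312Of_of_badMass_le` FAILS (at the residue characteristic of any bad place): the place-combinatorial TRUE-side
  mechanism of the companions is VOID over `ℚ`, where the fork is decided by depth alone (abc-iut-w5-d157's FALSE side at large depth,
  abc-iut-skel's `ForkGenuineDepthFamily` TRUE side at small depth).

Theorems about OUR typed objects; typed ≠ proved; no side taken. [cite: DupuyHilado2025, §3.6] [cite: Mochizuki2012, IUTchIII Cor. 3.12 p. 173–174]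
[claim: Mochizuki2012, status: disputed] for every IUT quotation.
-/

noncomputable section

open Finset NumberField IsDedekindDomain Literature.IUT.LogVolume

namespace Summit.ABC.IUTFork

namespace SplitBadPrime

/-- `Σ_{i<m} (i+1)² ≥ m + 3 > m` for `m ≥ 2` (`1 + 4 + 1 + ⋯`). [folklore] -/
theorem sum_sq_gt_of_two_le (m : ℕ) (hm : 2 ≤ m) :
    (m : ℝ) < ∑ i : Fin m, ((((i : ℕ) : ℝ) + 1) ^ 2) := by
  rw [Fin.sum_univ_eq_sum_range (fun n => (((n : ℝ) + 1) ^ 2)) m]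
  have key : ∀ m : ℕ, 2 ≤ m → (m : ℝ) + 3 ≤ ∑ n ∈ range m, (((n : ℝ) + 1) ^ 2) := by
    intro m hm
    induction m, hm using Nat.le_induction with
    | base => simp [sum_range_succ]; norm_num
    | succ k hk ih =>
      rw [sum_range_succ]
      have h1 : (1 : ℝ) ≤ ((k : ℝ) + 1) ^ 2 := by
        have : (1 : ℝ) ≤ (k : ℝ) + 1 := by
          have : (0 : ℝ) ≤ k := Nat.cast_nonneg k
          linarith
        nlinarith
      push_cast
      linarith
  have := key m hm
  linarith

end SplitBadPrime

section Rational

variable {F₀ : Type} [Field F₀] [NumberField F₀] {K : Type} [Field K] [NumberField K] [Algebra F₀ K]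

/-- Over a degree-one base every place has local degree `1` (`Σ_{v|p} n_v = [F₀:ℚ] = 1`, one place over `p`). [folklore] -/
theorem localDegree_eq_one_of_finrank_eq_one (hF : Module.finrank ℚ F₀ = 1) {p : ℕ} [Fact p.Prime]
    (v : placesOver F₀ p) : localDegree F₀ v.1 = 1 := by
  have hsum := sum_localDegree F₀ p
  have hsub := ValLine.placesOver_subsingleton_of_finrank_eq_one hF p
  have h1 : ∑ w ∈ placesOver F₀ p, localDegree F₀ w = localDegree F₀ v.1 := by
    refine Finset.sum_eq_single_of_mem v.1 v.2 fun w hw hne => ?_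
    exact absurd (congrArg Subtype.val (hsub ⟨w, hw⟩ v)) hne
  rw [h1, hF] at hsum
  exact hsum

/-- **Over `F₀` of degree one, every rational prime under a bad place is TOTALLY bad**: the bad mass
`β_p = Σ_{v|p, v∈𝕍^bad} Pr(v)` of any genuine Θ-volume input equals `1` there. [cite: DupuyHilado2025, §3.6] -/
theorem badMass_eq_one_of_finrank_eq_one (hF : Module.finrank ℚ F₀ = 1) (I : ThetaVolumeInput F₀ K) {p : ℕ} [Fact p.Prime]
    (v₀ : placesOver F₀ p) (hv₀ : v₀.1 ∈ I.X.S) :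
    ∑ v : placesOver F₀ p, (I.X.S : Set (HeightOneSpectrum (𝓞 F₀))).indicator (weight F₀) v.1 = 1 := by
  classical
  have hsub := ValLine.placesOver_subsingleton_of_finrank_eq_one hF p
  haveI : Subsingleton (placesOver F₀ p) := ⟨hsub⟩
  haveI : Unique (placesOver F₀ p) := uniqueOfSubsingleton v₀
  rw [Fintype.sum_unique]
  have hdef : (default : placesOver F₀ p) = v₀ := Subsingleton.elim _ _
  rw [hdef, Set.indicator_of_mem (Finset.mem_coe.mpr hv₀), weight, localDegree_eq_one_of_finrank_eq_one hF v₀, hF]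
  norm_num

/-- **Over `F₀` of degree one the sufficient condition of the TRUE side NEVER fires**: for every genuine Θ-volume input `I` the
hypothesis «`(1/ℓ⋇)·Σ_{i<ℓ⋇}(i+1)²·β_p^{i+1} ≤ 1` at every support prime» of abc-iut-c312-3's `cor312Of_of_badMass_le` FAILS — at
the residue characteristic of any bad place, `β_p = 1` and `(1/ℓ⋇)Σ(i+1)² = (ℓ⋇+1)(2ℓ⋇+1)/6 > 1`. So over `F_mod = ℚ` (the route to
`Summit.ABC`) the place-combinatorial escape of the companions is void and the fork is decided by depth alone. Typed objects; no side
taken. [claim: Mochizuki2012, status: disputed] [cite: DupuyHilado2025, §3.6] -/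
theorem not_badMass_condition_of_finrank_eq_one (hF : Module.finrank ℚ F₀ = 1) (I : ThetaVolumeInput F₀ K) :
    ¬ ∀ p ∈ I.supportPrimes, (1 / (I.lstar : ℝ)) * ∑ i : Fin I.lstar, (((i : ℕ) + 1 : ℝ) ^ 2) *
        (∑ v : placesOver F₀ p, (I.X.S : Set (HeightOneSpectrum (𝓞 F₀))).indicator (weight F₀) v.1) ^ ((i : ℕ) + 1) ≤ 1 := by
  intro h
  obtain ⟨w, hw⟩ := I.X.S_nonempty
  haveI : Fact (residueChar F₀ w).Prime := ⟨residueChar_prime F₀ w⟩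
  have hc := h (residueChar F₀ w) (I.residueChar_mem_supportPrimes hw)
  rw [badMass_eq_one_of_finrank_eq_one hF I ⟨w, mem_placesOver_residueChar w⟩ hw] at hc
  simp only [one_pow, mul_one] at hc
  have hl2 := I.X.two_le_lstar
  have hl : (0 : ℝ) < I.lstar := by exact_mod_cast (by omega : 0 < I.X.lstar)
  rw [one_div, inv_mul_le_iff₀ hl, mul_one] at hc
  have hgt := SplitBadPrime.sum_sq_gt_of_two_le I.lstar hl2
  linarith

end Rational

end Summit.ABC.IUTFork

end
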